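import Summits.QuantumFields.GaugeBoot.TiltedBoxRedLinkWitness
import Summits.QuantumFields.GaugeBoot.PeriodicPairTerms
import HarnessLib

/-!
# The reduced half of the link mirror of the odd square tilted box: the trick sum (gauge-boot, L3 supplement: reduced-half in-plane mirrors, 4/7)

HONEST FRAMING (cell `pub-gaugeboot`, page 1 of every file): the venture produces certified bounds
on lattice expectations at stated coupling, gauge group, dimension and torus size; NOT a mass gap,
NOT a continuum limit, NOT a string tension; NOT Yang–Mills-summit-bearing (barriers
`FixedCouplingUltralocality`, `PerturbativeInvisibility`). This module is bookkeeping for a small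
structural NEGATIVE result (the REDUCED-half in-plane mirrors of the square tilted boxes are not of
positive type in `d ≥ 3` at small coupling); it discharges nothing by itself.

## Content (odd box `ℤ^d/Γ(2P+1, 2P+1, L)`, `P ≥ 2`, link mirror `Θ_i`, compact metrisable `G`, continuous `ρ`)

The RP pairing of the witness `F = (W_v - W_{v+T}) e^{β E}` of `TiltedBoxRedLinkWitness.lean` is a
POSITIVE multiple of a finite sum of strong-coupling pair terms (`PeriodicPairTerms.lean`):

* the four plaquettes `vLo = v = (y₋; q)`, `vLoT = v + T` (layer `P`), `vUp = v + 2e_i`,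
  `vUpT = v + 2e_i + T` (layer `P + 2`; `Θ_i v = vUpT`, `Θ_i (v+T) = vUp`);
* `trickSum d i j L P ρ q β = ∑_{Q ⊆ rest} (T_Q(vUpT, vLo) - T_Q(vUpT, vLoT) - T_Q(vUp, vLo) + T_Q(vUp, vLoT))`
  — FAR pairs `(vUpT, vLo)`, `(vUp, vLoT)` with `+`, NEAR (vertically aligned) pairs
  `(vUpT, vLoT)`, `(vUp, vLo)` with `-`;
* ★ **`integral_redF_pair_eq`**:
  `∫ conj F(Θ_i U) F(U) dμ_β = (e^{-βN|rest|} / Z) · trickSum`;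
* ★ **`exists_redLink_neg_of_trickSum_neg`** / **`not_redLinkRP_of_trickSum_neg`**: if
  `trickSum < 0` then the witness is a bounded measurable observable of the REDUCED half
  `{1 ≤ x_i ≤ P}` (`TwoDim.IsRedLink`) with negative RP pairing, so reduced-half link RP
  along `i` — the shape of gen 50's positive two-dimensional theorem
  `TwoDim.tiltedBox_midAxisRP_odd_twoDim` — FAILS at that `β`.

That `trickSum < 0` for small `β > 0` in `d ≥ 3` is the content of parts 5–7. Elementary.
-/

noncomputable section

open QuotientAddGroup Finset Function MeasureTheory
open scoped ComplexConjugate ComplexOrder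

namespace Summit.QuantumFields.GaugeBoot

namespace TiltedRP

namespace RedLink

variable {d : ℕ} {i j : Fin d} {L P N : ℕ} [NeZero L] [NeZero P]
variable {G : Type*} [Group G] [TopologicalSpace G] [IsTopologicalGroup G] [CompactSpace G]
  [MeasurableSpace G] [BorelSpace G] [SecondCountableTopology G]
variable (ρ : G →* Matrix (Fin N) (Fin N) ℂ) (q : DirPair d)

/-! ## The four witness plaquettes -/

variable (d i j L P) in
/-- The lower witness plaquette `v = (y₋; q)` (transverse, layer `P`). [folklore] -/
def vLo : Plaq (TiltedSite d i j (2 * P + 1) (2 * P + 1) L) d := (oddLayerSite d i j L P, q)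

variable (d i j L P) in
/-- Its twist-translate `v + T`. [folklore] -/
def vLoT : Plaq (TiltedSite d i j (2 * P + 1) (2 * P + 1) L) d :=
  (oddLayerSite d i j L P + tiltedTwist d L (2 * P + 1), q)

variable (d i j L P) in
/-- The plaquette `v + 2e_i` vertically above `v` (layer `P + 2`): the mirror image of `v + T`. [folklore] -/
def vUp : Plaq (TiltedSite d i j (2 * P + 1) (2 * P + 1) L) d :=
  (oddLayerSite d i j L P + tiltedUnit d i j (2 * P + 1) (2 * P + 1) L i + tiltedUnit d i j (2 * P + 1) (2 * P + 1) L i, q)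

variable (d i j L P) in
/-- The plaquette `v + 2e_i + T` above `v + T`: the mirror image of `v`. [folklore] -/
def vUpT : Plaq (TiltedSite d i j (2 * P + 1) (2 * P + 1) L) d :=
  (oddLayerSite d i j L P + tiltedUnit d i j (2 * P + 1) (2 * P + 1) L i + tiltedUnit d i j (2 * P + 1) (2 * P + 1) L i +
    tiltedTwist d L (2 * P + 1), q)

variable (d i j L P) in
/-- **The trick sum**: `∑_{Q ⊆ rest} (T_Q(vUpT,vLo) - T_Q(vUpT,vLoT) - T_Q(vUp,vLo) + T_Q(vUp,vLoT))`
(far pairs `+`, near pairs `-`). [folklore] -/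
def trickSum (β : ℝ) : ℝ :=
  ∑ Q ∈ (restSetL d i j L P).powerset,
    (PairExp.pairT ρ (tiltedUnit d i j (2 * P + 1) (2 * P + 1) L) β Q (vUpT d i j L P q) (vLo d i j L P q) -
      PairExp.pairT ρ (tiltedUnit d i j (2 * P + 1) (2 * P + 1) L) β Q (vUpT d i j L P q) (vLoT d i j L P q) -
      PairExp.pairT ρ (tiltedUnit d i j (2 * P + 1) (2 * P + 1) L) β Q (vUp d i j L P q) (vLo d i j L P q) +
      PairExp.pairT ρ (tiltedUnit d i j (2 * P + 1) (2 * P + 1) L) β Q (vUp d i j L P q) (vLoT d i j L P q))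

/-! ## The RP pairing of the witness is a positive multiple of the trick sum -/

omit [NeZero P] [MeasurableSpace G] [BorelSpace G] [SecondCountableTopology G] in
/-- The pair integrand of the witness, unfolded into plaquette observables. [folklore] -/
theorem redDiff_pair_eq (hij : i ≠ j) (hq1 : q.1.1 ≠ i) (hq2 : q.1.2 ≠ i) (hρ : Continuous ρ) (β : ℝ)
    (U : Config (TiltedSite d i j (2 * P + 1) (2 * P + 1) L) d G) :
    redDiff ρ q (configMidReflect (tiltedUnit d i j (2 * P + 1) (2 * P + 1) L) i (tiltedAxisFlip d L (2 * P + 1) hij) U) *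
        redDiff ρ q U *
        ∏ p ∈ restSetL d i j L P, Real.exp (β * plaqObs ρ (tiltedUnit d i j (2 * P + 1) (2 * P + 1) L) p U) =
      (plaqObs ρ (tiltedUnit d i j (2 * P + 1) (2 * P + 1) L) (vUpT d i j L P q) U -
          plaqObs ρ (tiltedUnit d i j (2 * P + 1) (2 * P + 1) L) (vUp d i j L P q) U) *
        (plaqObs ρ (tiltedUnit d i j (2 * P + 1) (2 * P + 1) L) (vLo d i j L P q) U -
          plaqObs ρ (tiltedUnit d i j (2 * P + 1) (2 * P + 1) L) (vLoT d i j L P q) U) *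
        PairExp.restW ρ (tiltedUnit d i j (2 * P + 1) (2 * P + 1) L) β (restSetL d i j L P) U := by
  rw [redDiff_configReflect ρ q hij hq1 hq2 hρ]
  rfl

/-- ★ **The RP pairing of the witness**:
`∫ conj F(Θ_i U) F(U) dμ_β = (e^{-βN|rest|} / Z) · trickSum`. [folklore] -/
theorem integral_redF_pair_eq (hP : 2 ≤ P) (hij : i ≠ j) (hq1 : q.1.1 ≠ i) (hq2 : q.1.2 ≠ i)
    (hρ : Continuous ρ) (β : ℝ) :
    ∫ U, conj (redF ρ q β (configMidReflect (tiltedUnit d i j (2 * P + 1) (2 * P + 1) L) i (tiltedAxisFlip d L (2 * P + 1) hij) U)) *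
        redF ρ q β U ∂(gibbs ρ (tiltedUnit d i j (2 * P + 1) (2 * P + 1) L) β) =
      (((Real.exp (-(β * N * (restSetL d i j L P).card)) /
          ∫ U, Real.exp (-β * wilsonAction ρ (tiltedUnit d i j (2 * P + 1) (2 * P + 1) L) U)
            ∂(productHaar (TiltedSite d i j (2 * P + 1) (2 * P + 1) L) d G)) * trickSum d i j L P ρ q β : ℝ) : ℂ) := by
  rw [integral_gibbs]
  set Z := ∫ U, Real.exp (-β * wilsonAction ρ (tiltedUnit d i j (2 * P + 1) (2 * P + 1) L) U)
    ∂(productHaar (TiltedSite d i j (2 * P + 1) (2 * P + 1) L) d G) with hZ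
  -- Step 1: against the product Haar measure, with the Boltzmann weight cancelled by the trick
  have h1 : ∀ U : Config (TiltedSite d i j (2 * P + 1) (2 * P + 1) L) d G,
      (Real.exp (-β * wilsonAction ρ (tiltedUnit d i j (2 * P + 1) (2 * P + 1) L) U) / Z) •
          (conj (redF ρ q β (configMidReflect (tiltedUnit d i j (2 * P + 1) (2 * P + 1) L) i (tiltedAxisFlip d L (2 * P + 1) hij) U)) *
            redF ρ q β U) =
        (((1 / Z) * (Real.exp (-(β * N * (restSetL d i j L P).card)) *
          (redDiff ρ q (configMidReflect (tiltedUnit d i j (2 * P + 1) (2 * P + 1) L) i (tiltedAxisFlip d L (2 * P + 1) hij) U) *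
            redDiff ρ q U *
            ∏ p ∈ restSetL d i j L P, Real.exp (β * plaqObs ρ (tiltedUnit d i j (2 * P + 1) (2 * P + 1) L) p U))) : ℝ) : ℂ) := by
    intro U
    have hb := boltzmann_redF ρ q hP hij hρ β U
    rw [Complex.real_smul]
    push_cast at hb ⊢
    linear_combination (1 / (Z : ℂ)) * hb
  simp_rw [h1]
  rw [integral_complex_ofReal, integral_const_mul, integral_const_mul]
  -- Step 2: the cluster expansion of the difference form
  simp_rw [redDiff_pair_eq ρ q hij hq1 hq2 hρ β]
  rw [PairExp.integral_diff_mul_diff_restW_eq_sum ρ _ β hρ]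
  unfold trickSum
  push_cast
  ring

/-! ## A negative trick sum refutes reduced-half reflection positivity -/

/-- ★ **If the trick sum is negative, the witness has a negative RP pairing**: it is measurable,
bounded, reads only the links of the reduced half `{1 ≤ x_i ≤ P}`, and
`∫ conj F(Θ_i U) F(U) dμ_β < 0`. [folklore] -/
theorem exists_redLink_neg_of_trickSum_neg (hP : 2 ≤ P) (hij : i ≠ j) (hq1 : q.1.1 ≠ i) (hq2 : q.1.2 ≠ i)
    (hρ : Continuous ρ) {β : ℝ} (hneg : trickSum d i j L P ρ q β < 0) :
    ∃ F : Config (TiltedSite d i j (2 * P + 1) (2 * P + 1) L) d G → ℂ, Measurable F ∧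
      (∃ C : ℝ, ∀ U, ‖F U‖ ≤ C) ∧
      (∀ U V : Config (TiltedSite d i j (2 * P + 1) (2 * P + 1) L) d G,
        (∀ l, TwoDim.IsRedLink (P := P) l → U l = V l) → F U = F V) ∧
      ∫ U, conj (F (configMidReflect (tiltedUnit d i j (2 * P + 1) (2 * P + 1) L) i (tiltedAxisFlip d L (2 * P + 1) hij) U)) * F U
        ∂(gibbs ρ (tiltedUnit d i j (2 * P + 1) (2 * P + 1) L) β) < 0 := by
  refine ⟨fun U => redF ρ q β U, measurable_redF ρ q hρ β, exists_norm_redF_le ρ q hρ β,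
    redF_eq_of_redLinks ρ q hP hij hq1 hq2 β, ?_⟩
  have hZ := normaliser_pos (A := TiltedSite d i j (2 * P + 1) (2 * P + 1) L) (G := G) ρ hρ
    (tiltedUnit d i j (2 * P + 1) (2 * P + 1) L) β
  have hc : 0 < Real.exp (-(β * N * (restSetL d i j L P).card)) /
      ∫ U, Real.exp (-β * wilsonAction ρ (tiltedUnit d i j (2 * P + 1) (2 * P + 1) L) U)
        ∂(productHaar (TiltedSite d i j (2 * P + 1) (2 * P + 1) L) d G) := div_pos (Real.exp_pos _) hZ
  rw [show (fun U => conj (redF ρ q β (configMidReflect (tiltedUnit d i j (2 * P + 1) (2 * P + 1) L) i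
      (tiltedAxisFlip d L (2 * P + 1) hij) U)) * redF ρ q β U) = fun U => conj (redF ρ q β (configMidReflect
      (tiltedUnit d i j (2 * P + 1) (2 * P + 1) L) i (tiltedAxisFlip d L (2 * P + 1) hij) U)) * redF ρ q β U from rfl,
    integral_redF_pair_eq ρ q hP hij hq1 hq2 hρ β]
  exact_mod_cast mul_neg_of_pos_of_neg hc hneg

/-- ★ **A negative trick sum refutes REDUCED-half site reflection positivity along `i`** on the even
square tilted box — the shape of `TwoDim.tiltedBox_midAxisRP_odd_twoDim` (gen 50, `d = 2`, where it
HOLDS at every `β`). [folklore] -/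
theorem not_redLinkRP_of_trickSum_neg (hP : 2 ≤ P) (hij : i ≠ j) (hq1 : q.1.1 ≠ i) (hq2 : q.1.2 ≠ i)
    (hρ : Continuous ρ) {β : ℝ} (hneg : trickSum d i j L P ρ q β < 0) :
    ¬ ∀ F : Config (TiltedSite d i j (2 * P + 1) (2 * P + 1) L) d G → ℂ, Measurable F →
        (∃ C : ℝ, ∀ U, ‖F U‖ ≤ C) →
        (∀ U V : Config (TiltedSite d i j (2 * P + 1) (2 * P + 1) L) d G,
          (∀ l, TwoDim.IsRedLink (P := P) l → U l = V l) → F U = F V) →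
        0 ≤ ∫ U, conj (F (configMidReflect (tiltedUnit d i j (2 * P + 1) (2 * P + 1) L) i
          (tiltedAxisFlip d L (2 * P + 1) hij) U)) * F U ∂(gibbs ρ (tiltedUnit d i j (2 * P + 1) (2 * P + 1) L) β) := by
  intro hRP
  obtain ⟨F, hFm, hFb, hFo, hlt⟩ := exists_redLink_neg_of_trickSum_neg ρ q hP hij hq1 hq2 hρ hneg
  exact lt_irrefl _ (lt_of_le_of_lt (hRP F hFm hFb hFo) hlt)

end RedLink

end TiltedRP

end Summit.QuantumFields.GaugeBoot

end
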